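import Literature.Probability.Percolation.TrapTermFence
import Literature.Probability.Percolation.TrapFinalCrossing
import HarnessLib

/-!
# Pieces of an arm inside the trapezoid, and its approach to a fence zone

Topic `Literature/Probability/Percolation`; family `crit-perc` / near-critical percolation on `𝕋`.
Bricks of the near-critical arm-separation theorem for four arms in the ADJACENT colour
arrangement (P. Nolin, EJP 13 (2008), Thm. 11, `j = 4`, `σ = BBWW` [arXiv 0711.4948: Thm. 10];
the last missing input `hsepAdj` of `Werner2009_lemma63_of_altSeparation_of_adjSeparation`).
Book-keeping along an arm (a self-avoiding `𝕋`-walk of `{n ≤ |v| ≤ 2M}` starting in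
`{v₀ ≤ M}`) for the rerouting of two arms of the same colour (Nolin 2008, §4.4, proof of
Lemma 15, last paragraph; organised in the tree through Menger's theorem):

* `exists_entry_subwalk` — for a vertex `x` of the arm with `x₀ > M`, the piece of the arm inside
  the trapezoid ending at `x`: a sub-walk `γ : f ⇝ x` from a site `f ∈ trapI M`, inside `trapD M`,
  using only vertices of the arm up to `x` (generalises `exists_final_crossing_walk`);
* `exists_last_contact` — (**the approach to a fence zone**) if a vertex `q` of an open arm lies
  in the `3k`-box about the tip `z` of a raw-good term `c` (inner exclusion ring at scale `k`) and
  off `lower c z`, then the arm met `c` before `q`, at a last site `ℓ ∈ c` of `lower c z` before `q`,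
  and the piece of the arm from `ℓ` to `q` lies, `ℓ` excepted, off `lower c z`, inside the trapezoid
  and inside the `7k`-box about `z` (`ℓ` itself in the `7k`-box);
* `not_mem_of_segment_offLower` — such a piece meets no open crossing `c'` lying off `lower c z`
  that starts on `trapI M` (outer ring: the later terms), and trivially no set inside `lower c z`
  (the earlier terms).

Everything here is proved; no named facts are introduced.

## References

* P. Nolin, Near-critical percolation in two dimensions, *Electron. J. Probab.* 13 (2008), §4.4,
  proof of Lemma 15 (arXiv 0711.4948: Lemma 14) [Nolin2008].
* H. Kesten, Scaling relations for 2D-percolation, *Comm. Math. Phys.* 109 (1987), Lemma 2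
  [Kesten1987].

Tree: `TrapRawOK.inner_ring`, `TrapRawOK.not_box17_of_offLower` (`ArmSeparationRawGood.lean`,
`TrapTermFence.lean`), `exists_append_last_mem` (`MengerTwo.lean`), `JDomain.mem_above_of_adj`,
`JDomain.mem_lower_iff_not_mem_above`, `JDomain.lower_subset_D`, `mem_trapD_of_triNorm_le`,
`triGraph_adj_coord`, `PathIn.of_walk_mem_support`.
-/

noncomputable section

open Set

namespace Literature.Probability.Percolation

open LatticeModels Literature.Combinatorics.SimpleGraph

/-! ### The piece of an arm inside the trapezoid ending at a vertex -/

/-- **The piece inside the trapezoid ending at `x`.** Let `α : a ⇝ y` be a self-avoiding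
`𝕋`-walk with all vertices in `{|v| ≤ 2M}` and `a₀ ≤ M`, and let `x` be a vertex of `α` with
`x₀ > M`. Then the part of `α` up to `x`, after its last visit of `{v₀ ≤ M}`, is a self-avoiding
walk `γ : f ⇝ x` from a site `f ∈ trapI M` inside `trapD M`, all of whose vertices are vertices of
`α.takeUntil x`. [cite: Nolin2008, §4.4 (arXiv 0711.4948: proof of Lemma 14)] -/
theorem exists_entry_subwalk {M : ℕ} {a y : Site 2} (α : triGraph.Walk a y) (hα : α.IsPath)
    (hsupp : ∀ v ∈ α.support, triNorm v ≤ 2 * M) (ha0 : a 0 ≤ M) {x : Site 2} (hx : x ∈ α.support)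
    (hx0 : (M : ℤ) < x 0) :
    ∃ (f : Site 2) (β : triGraph.Walk a f) (γ : triGraph.Walk f x), α.takeUntil x hx = β.append γ ∧ f ∈ trapI M ∧
      γ.IsPath ∧ (∀ v ∈ γ.support, v ∈ trapD M) ∧ (∀ v ∈ γ.support, v ∈ (α.takeUntil x hx).support) := by
  classical
  set αx := α.takeUntil x hx with hαx
  have hαxpath : αx.IsPath := hα.takeUntil hx
  have hsub : ∀ v ∈ αx.support, v ∈ α.support := fun v hv => α.support_takeUntil_subset_support hx hv
  -- the last vertex of `αx` in `C = {v₀ ≤ M}`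
  set C : Set (Site 2) := {v | v 0 ≤ M} with hC
  obtain ⟨p, β₀, γ₀, hαeq, hpC, hplast⟩ := exists_append_last_mem C αx ⟨a, αx.start_mem_support, ha0⟩
  have hpC' : p 0 ≤ M := hpC
  have hpx : p ≠ x := fun h => by rw [h] at hpC'; omega
  obtain ⟨f, hpf, γ, hγ₀⟩ := SimpleGraph.Walk.exists_eq_cons_of_ne hpx γ₀
  have hpath₀ : (β₀.append γ₀).IsPath := by rw [← hαeq]; exact hαxpath
  have hγ₀path : γ₀.IsPath := (isPath_append_iff'.1 hpath₀).2.1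
  rw [hγ₀] at hγ₀path
  have hγpath : γ.IsPath := ((SimpleGraph.Walk.cons_isPath_iff hpf γ).1 hγ₀path).1
  have hpγ : p ∉ γ.support := ((SimpleGraph.Walk.cons_isPath_iff hpf γ).1 hγ₀path).2
  have hγsub₀ : ∀ v ∈ γ.support, v ∈ γ₀.support := fun v hv => by rw [hγ₀]; exact List.mem_cons_of_mem _ hv
  have hγsub : ∀ v ∈ γ.support, v ∈ αx.support := fun v hv => by
    rw [hαeq, SimpleGraph.Walk.mem_support_append_iff]; exact Or.inr (hγsub₀ v hv)
  have hγC : ∀ v ∈ γ.support, (M : ℤ) < v 0 := by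
    intro v hv
    by_contra h
    have hvC : v ∈ C := not_lt.1 h
    exact hpγ ((hplast v (hγsub₀ v hv) hvC) ▸ hv)
  have hγD : ∀ v ∈ γ.support, v ∈ trapD M := fun v hv =>
    mem_trapD_of_triNorm_le (hγC v hv) (hsupp v (hsub v (hγsub v hv)))
  have hf0 : f 0 = (M : ℤ) + 1 := by
    have h1 := hγC f γ.start_mem_support
    have h2 := (triGraph_adj_coord hpf 0).2
    omega
  have hfI : f ∈ trapI M := mem_trapI.2 ⟨hγD f γ.start_mem_support, hf0⟩
  refine ⟨f, β₀.concat hpf, γ, ?_, hfI, hγpath, hγD, hγsub⟩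
  rw [hαeq, hγ₀, SimpleGraph.Walk.concat_eq_append, ← SimpleGraph.Walk.append_assoc, SimpleGraph.Walk.cons_append,
    SimpleGraph.Walk.nil_append]

/-! ### The approach of an open arm to a fence zone -/

/-- **The last contact before entering a fence zone.** Let `c` (tip `z`) be a crossing of
`trapDomain M`, raw-good at scale `k ≥ 1` (`7k + 1 ≤ M`), and let `α : a ⇝ y` be a self-avoiding
open `𝕋`-walk of `{|v| ≤ 2M}` starting outside the `7k`-box about `z` (`a₀ ≤ z₀ - 7k`). If a
vertex `q` of `α` lies in the `3k`-box about `z` and off `lower c z`, then the part of `α` up to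
`q` meets `lower c z`; after its last vertex `ℓ` in `lower c z` — a site of `c` in the `7k`-box —
it is a walk `γ' : s ⇝ q` (with `ℓ ~ s`) all of whose vertices are off `lower c z`, inside
`trapD M`, in `above c z` and inside the `7k`-box about `z` (inner exclusion ring: an open path
off `lower c z` from the `3k`-box stays in the `7k`-box). [cite: Nolin2008, §4.4 Lemma 15 (proof) (arXiv 0711.4948: Lemma 14)] -/
theorem exists_last_contact {M k : ℕ} {c : Finset (Site 2)} {z : Site 2} {ω : SiteConfig (Site 2)}
    (h : TrapRawOK M c z k ω) (hk : 1 ≤ k) (hkM : 7 * (k : ℤ) + 1 ≤ M) (hc : (trapDomain M).IsCrossing c z)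
    {a y : Site 2} (α : triGraph.Walk a y) (hα : α.IsPath) (hsupp : ∀ v ∈ α.support, triNorm v ≤ 2 * M)
    (hω : ∀ v ∈ α.support, v ∈ ω) (ha : a 0 ≤ z 0 - 7 * k) {q : Site 2} (hq : q ∈ α.support)
    (hqbox : z 0 - 3 * k ≤ q 0 ∧ q 0 ≤ z 0 + 3 * k ∧ z 1 - 3 * k ≤ q 1 ∧ q 1 ≤ z 1 + 3 * k)
    (hql : q ∉ (trapDomain M).lower c z) :
    ∃ (ℓ s : Site 2) (β : triGraph.Walk a ℓ) (hℓs : triGraph.Adj ℓ s) (γ' : triGraph.Walk s q),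
      α.takeUntil q hq = β.append (SimpleGraph.Walk.cons hℓs γ') ∧ ℓ ∈ c ∧
      (z 0 - 7 * k - 1 ≤ ℓ 0 ∧ ℓ 0 ≤ z 0 + 7 * k ∧ z 1 - 7 * k - 1 ≤ ℓ 1 ∧ ℓ 1 ≤ z 1 + 7 * k) ∧
      (∀ v ∈ γ'.support, v ∉ (trapDomain M).lower c z ∧ v ∈ trapD M ∧ v ∈ (trapDomain M).above c z ∧
        (z 0 - 7 * k < v 0 ∧ v 0 < z 0 + 7 * k ∧ z 1 - 7 * k < v 1 ∧ v 1 < z 1 + 7 * k)) ∧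
      (∀ v ∈ γ'.support, v ∈ (α.takeUntil q hq).support) ∧ ℓ ∈ (α.takeUntil q hq).support := by
  classical
  set αq := α.takeUntil q hq with hαq
  have hαqpath : αq.IsPath := hα.takeUntil hq
  have hsub : ∀ v ∈ αq.support, v ∈ α.support := fun v hv => α.support_takeUntil_subset_support hq hv
  set L : Set (Site 2) := ↑((trapDomain M).lower c z) with hL
  have hz := trapO_coord (tip_mem_trapO hc)
  -- the inner ring, applied along the open walk
  have hring : ∀ {s t : Site 2}, PathIn triGraph (Lᶜ ∩ ω) s t →
      (z 0 - 3 * k ≤ s 0 ∧ s 0 ≤ z 0 + 3 * k ∧ z 1 - 3 * k ≤ s 1 ∧ s 1 ≤ z 1 + 3 * k) →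
      ¬ (t 0 ≤ z 0 - 7 * k ∨ z 0 + 7 * k ≤ t 0 ∨ t 1 ≤ z 1 - 7 * k ∨ z 1 + 7 * k ≤ t 1) :=
    fun hp hs ht => h.inner_ring hk hs ht hp
  -- `αq` meets `L`: otherwise it is an open path off `L` from the `3k`-box to `a`, outside the `7k`-box
  have hmeet : ∃ v ∈ αq.support, v ∈ L := by
    by_contra hno
    push Not at hno
    have hp : PathIn triGraph (Lᶜ ∩ ω) q a :=
      (PathIn.of_walk_mem_support αq (A := Lᶜ ∩ ω) (fun v hv => ⟨hno v hv, hω v (hsub v hv)⟩) αq.end_mem_support).1.symm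
    exact hring hp hqbox (Or.inl ha)
  obtain ⟨ℓ, β, γ, hαeq, hℓL, hℓlast⟩ := exists_append_last_mem L αq hmeet
  have hγsub : ∀ v ∈ γ.support, v ∈ αq.support := fun v hv => by
    rw [hαeq, SimpleGraph.Walk.mem_support_append_iff]; exact Or.inr hv
  have hℓq : ℓ ≠ q := fun h' => hql (by rw [← h']; exact Finset.mem_coe.1 hℓL)
  obtain ⟨s, hℓs, γ', hγ'⟩ := SimpleGraph.Walk.exists_eq_cons_of_ne hℓq γ
  have hpath₀ : (β.append γ).IsPath := by rw [← hαeq]; exact hαqpath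
  have hγpath : γ.IsPath := (isPath_append_iff'.1 hpath₀).2.1
  rw [hγ'] at hγpath
  have hℓγ' : ℓ ∉ γ'.support := ((SimpleGraph.Walk.cons_isPath_iff hℓs γ').1 hγpath).2
  have hγ'sub : ∀ v ∈ γ'.support, v ∈ γ.support := fun v hv => by rw [hγ']; exact List.mem_cons_of_mem _ hv
  -- the vertices of `γ'` are off `L`, open
  have hoff : ∀ v ∈ γ'.support, v ∉ L := fun v hv hvL =>
    hℓγ' ((hℓlast v (hγ'sub v hv) hvL) ▸ hv)
  have hγ'A : ∀ v ∈ γ'.support, v ∈ Lᶜ ∩ ω := fun v hv => ⟨hoff v hv, hω v (hsub v (hγsub v (hγ'sub v hv)))⟩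
  -- hence joined to `q` off `L`, hence inside the `7k`-box
  have hbox : ∀ v ∈ γ'.support, z 0 - 7 * k < v 0 ∧ v 0 < z 0 + 7 * k ∧ z 1 - 7 * k < v 1 ∧ v 1 < z 1 + 7 * k := by
    intro v hv
    have hp : PathIn triGraph (Lᶜ ∩ ω) q v :=
      (PathIn.of_walk_mem_support γ' (A := Lᶜ ∩ ω) hγ'A hv).2.symm
    have := hring hp hqbox
    omega
  have hD : ∀ v ∈ γ'.support, v ∈ trapD M := fun v hv =>
    mem_trapD_of_triNorm_le (by have := (hbox v hv).1; omega) (hsupp v (hsub v (hγsub v (hγ'sub v hv))))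
  have habove : ∀ v ∈ γ'.support, v ∈ (trapDomain M).above c z := fun v hv => by
    have hvD : v ∈ (trapDomain M).D := hD v hv
    by_contra hna
    exact hoff v hv (Finset.mem_coe.2 ((JDomain.mem_lower_iff_not_mem_above hvD).2 hna))
  -- `ℓ ∈ c`: it is in `lower c z`, adjacent to the site `s` above
  have hsa := habove s γ'.start_mem_support
  have hℓD : ℓ ∈ (trapDomain M).D := JDomain.lower_subset_D hc.subset (Finset.mem_coe.1 hℓL)
  have hℓc : ℓ ∈ c := by
    by_contra hℓc
    have hℓa : ℓ ∈ (trapDomain M).above c z := JDomain.mem_above_of_adj hsa hℓD hℓc hℓs.symm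
    exact (JDomain.mem_lower_iff_not_mem_above hℓD).1 (Finset.mem_coe.1 hℓL) hℓa
  have hℓbox : z 0 - 7 * k - 1 ≤ ℓ 0 ∧ ℓ 0 ≤ z 0 + 7 * k ∧ z 1 - 7 * k - 1 ≤ ℓ 1 ∧ ℓ 1 ≤ z 1 + 7 * k := by
    have hs := hbox s γ'.start_mem_support
    have h0 := triGraph_adj_coord hℓs 0
    have h1 := triGraph_adj_coord hℓs 1
    omega
  refine ⟨ℓ, s, β, hℓs, γ', by rw [hαeq, hγ'], hℓc, hℓbox, fun v hv => ⟨?_, hD v hv, habove v hv, hbox v hv⟩,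
    fun v hv => hγsub v (hγ'sub v hv), hγsub ℓ γ.start_mem_support⟩
  exact fun hvl => hoff v hv (Finset.mem_coe.2 hvl)

/-- **The piece before a fence zone meets no later term.** In the situation of
`exists_last_contact`, a vertex of `γ'` (off `lower c z`, in the `7k`-box) is not a site of an
open crossing `c'` lying off `lower c z` (outer exclusion ring: `c'` joins it to `trapI M`, outside
the `31k`-box; `31k + 1 ≤ M`). The earlier terms, inside `lower c z`, are avoided trivially. [cite: Nolin2008, §4.4 Lemma 15 (proof) (arXiv 0711.4948: Lemma 14)] -/
theorem not_mem_of_box7_offLower {M k : ℕ} {c : Finset (Site 2)} {z : Site 2} {ω : SiteConfig (Site 2)}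
    (h : TrapRawOK M c z k ω) (hk : 1 ≤ k) (hkM : 31 * (k : ℤ) + 1 ≤ M) (hc : (trapDomain M).IsCrossing c z)
    {c' : Finset (Site 2)} {z' : Site 2} (hc' : (trapDomain M).IsCrossing c' z') (hc'ω : (↑c' : Set (Site 2)) ⊆ ω)
    (hoff : ∀ v ∈ c', v ∉ (trapDomain M).lower c z) {v : Site 2}
    (hv : z 0 - 7 * k < v 0 ∧ v 0 < z 0 + 7 * k ∧ z 1 - 7 * k < v 1 ∧ v 1 < z 1 + 7 * k) : v ∉ c' := by
  intro hvc'
  obtain ⟨f, hfc', hfI⟩ := hc'.exists_start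
  have hz := trapO_coord (tip_mem_trapO hc)
  have hf0 := (mem_trapI.1 hfI).2
  have hA : (↑c' : Set (Site 2)) ⊆ ((↑((trapDomain M).lower c z) : Set (Site 2))ᶜ ∩ ω) :=
    fun w hw => ⟨fun h' => hoff w (Finset.mem_coe.1 hw) (Finset.mem_coe.1 h'), hc'ω hw⟩
  exact h.not_box17_of_offLower hk hA (hc'.conn v hvc' f hfc') (Or.inl (by omega)) ⟨by omega, by omega, by omega, by omega⟩

end Literature.Probability.Percolation
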